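import Literature.NumberTheory.Automorphic.HeckeEulerFactorisationGL2
import Literature.NumberTheory.Automorphic.ArchRankinSelbergOfTorusKirillov
import Literature.NumberTheory.Automorphic.ArchTorusCoordinatesGL2
import HarnessLib

/-!
# The dual archimedean Hecke integrand as a Kirillov function
# (Jacquet–Langlands (1970), proof of Thm. 11.1, p. 173; §2 (2.18))

Topic `NumberTheory/Automorphic`; namespace `Literature.NumberTheory.Automorphic`. Theorems only (no
definition, no named fact, no instance).

In `HeckeEulerFactorisationGL2` the standard `L`-theory of `GL₂` (the named fact
`JacquetLanglands1970_standardLTheoryGL2`), Gelbart's Prop. 4.1 at the σ-unramified places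
(`frobSatakeCompatibleAt_of_isPiOfArtinRep_of_isUnramifiedAt`) and the Galois-twisted Hecke theory
(`JacquetLanglands1970_twistedHeckeTheoryGL2`) are reduced to ONE archimedean statement about the
archimedean component `τ` of a cuspidal `Π` (`integralRepresentation_clean_of_archHeckeTestVectorMin`): a
`K_∞`-finite Gårding vector `e₀` whose two archimedean Hecke integrals

  `Ψ_∞(s; e₀)  = ∫_{K_∞ˣ} W_{e₀}(diag(u,1)) N(u)^{s-1/2} d^×u`,
  `Ψ̃_∞(s; e₀) = ∫_{K_∞ˣ} W̃_{e₀}(diag(u,1)) N(u)^{s-1/2} d^×u`,   `W̃(g) = W(w ᵗg⁻¹)` (`tildeFn`),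

have entire reciprocals. The second integrand is there written with the involution `g ↦ w ᵗg⁻¹` of the
global theory. This file rewrites it in the language of the archimedean Kirillov model alone:

* `weylLong_two_mul_glTransposeInv_diagGL2` — `w ι(diag(u,1)) = (u⁻¹·1) diag(u,1) w` in `GL₂(R)`;
* `tildeFn_archWhittakerFn_diagGL2` — for `τ` with central character `ω`
  (`τ(c·1) = ω(c)`; Schur, `exists_apply_glDiagonal_const_eq_smul`):

    `W̃_{e}(diag(u,1)) = ω(u⁻¹) · W_{τ(w) e}(diag(u,1))`,

  i.e. the dual Hecke integrand of `e` is the `ω⁻¹`-twisted Kirillov function (`kirillovFn`) of the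
  `K_∞`-translate `τ(w) e` (`w ∈ K_∞`, `weylLong_mem_Kinf`), as on p. 173 of Jacquet–Langlands (1970)
  (there phrased with `W(diag(1,u⁻¹) w) = ω(u)⁻¹ W_{π(w)W}(diag(u,1))`);
* `integralRepresentation_clean_of_archHeckeTestVectorMinW`,
  `JacquetLanglands1970_standardLTheoryGL2_of_archHeckeTestVectorMinW`,
  `frobSatakeCompatibleAt_of_isPiOfArtinRep_of_isUnramifiedAt_of_archHeckeTestVectorMinW`,
  `JacquetLanglands1970_twistedHeckeTheoryGL2_and_frobSatakeCompatibleAt_of_archHeckeTestVectorMinW` — the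
  package `(IR)`, the standard `L`-theory, Gelbart's Prop. 4.1 (σ-unramified places) and the twisted Hecke
  theory from the KIRILLOV-ONLY archimedean input: for the archimedean component `τ` (central character `ω`
  supplied) of every cuspidal `Π`, one `K_∞`-finite Gårding vector `e₀` such that the Mellin transforms
  `∫ W_{e₀}(diag(u,1)) N(u)^{s-1/2} d^×u` and `∫ ω(u⁻¹) W_{τ(w)e₀}(diag(u,1)) N(u)^{s-1/2} d^×u` converge
  absolutely on a right half-plane and have there entire reciprocals whose zeros lie on finitely many
  horizontal lines (Jacquet–Langlands (1970), Thm. 5.15 / Thm. 6.4 for one vector).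

## References

* H. Jacquet, R. P. Langlands, *Automorphic Forms on GL(2)*, LNM 114 (1970), Thm. 2.18, Thm. 5.15, Thm. 6.4,
  Thm. 11.1 and its proof (pp. 171–173). [JacquetLanglands1970]
* S. Gelbart, *Three lectures on the modularity of ρ̄_{E,3} and the Langlands reciprocity conjecture*,
  in: Modular Forms and Fermat's Last Theorem (1997), Prop. 4.1. [Gelbart1997]
-/

noncomputable section

open MeasureTheory Measure NumberField NumberField.mixedEmbedding IsDedekindDomain Set Filter Topology
open Polynomial
open Literature.NumberTheory.GaloisRepresentations (coe_glTransposeInv_apply)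
open scoped MatrixGroups InnerProductSpace Classical NNReal ENNReal

namespace Literature.NumberTheory.Automorphic

/-! ### 1. The point `w ι(diag(u,1))` -/

section Point

variable {R : Type*} [CommRing R]

/-- `w diag(a, b) = diag(b, a) w` for the long Weyl element of `GL₂(R)`, `R` any commutative ring
(the field case is `weylLong_two_mul_diagGL2`). [folklore] -/
theorem weylLong_two_mul_diagGL2_comm (a b : Rˣ) : weylLong 2 R * diagGL2 a b = diagGL2 b a * weylLong 2 R := by
  refine Matrix.GeneralLinearGroup.ext fun i j => ?_
  rw [Units.val_mul, Units.val_mul, coe_diagGL2, coe_diagGL2, coe_weylLong]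
  fin_cases i <;> fin_cases j <;>
    simp [Matrix.mul_apply, Fin.sum_univ_two, Equiv.Perm.permMatrix, PEquiv.toMatrix_apply]

/-- `diag(1, c) = (c · 1) · diag(c⁻¹, 1)`. [folklore] -/
theorem diagGL2_one_eq_glDiagonal_const_mul (c : Rˣ) :
    (diagGL2 1 c : GL (Fin 2) R) = glDiagonal 2 R (fun _ => c) * diagGL2 c⁻¹ 1 := by
  rw [diagGL2, diagGL2, ← map_mul]
  congr 1
  funext i
  fin_cases i <;> simp

variable [TopologicalSpace R]

/-- `ι(diag(a, b)) = diag(a⁻¹, b⁻¹)` over any commutative ring (the field case is `glTransposeInv_diagGL2`).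
[folklore] -/
theorem glTransposeInv_diagGL2_comm (a b : Rˣ) : GaloisRepresentations.glTransposeInv (Fin 2) R (diagGL2 a b) = diagGL2 a⁻¹ b⁻¹ := by
  rw [diagGL2, glTransposeInv_glDiagonal, diagGL2]
  congr 1
  funext i
  fin_cases i <;> simp

/-- **`w ι(diag(u,1)) = (u⁻¹ · 1) · diag(u,1) · w`.** [folklore] -/
theorem weylLong_two_mul_glTransposeInv_diagGL2 (u : Rˣ) :
    weylLong 2 R * GaloisRepresentations.glTransposeInv (Fin 2) R (diagGL2 u 1) =
      glDiagonal 2 R (fun _ => u⁻¹) * (diagGL2 u 1 * weylLong 2 R) := by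
  rw [glTransposeInv_diagGL2_comm, inv_one, weylLong_two_mul_diagGL2_comm, diagGL2_one_eq_glDiagonal_const_mul,
    inv_inv, mul_assoc]

end Point

/-! ### 2. `W̃_e(diag(u,1)) = ω(u⁻¹) W_{τ(w)e}(diag(u,1))` -/

section Kirillov

variable {K : Type} [Field K] [NumberField K] {hcpt : isCompact_glFiniteIntegralLevel 2 K}
  {E : Type*} [NormedAddCommGroup E] [NormedSpace ℂ E] [CompleteSpace E]
  {τ : ContRepresentation ℂ (AutomorphyDatum.gl 2 K hcpt).arch.carrier E}

/-- **The dual archimedean Hecke integrand is a twisted Kirillov function** (Jacquet–Langlands (1970),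
p. 173): if the centre acts by `τ(c · 1) = ω(c)`, then for every Gårding vector `e` and `u ∈ K_∞ˣ`

  `W̃_e(diag(u,1)) = W_e(w ι(diag(u,1))) = ω(u⁻¹) · W_{τ(w)e}(diag(u,1))`,

where `W_e(g) = ℓ(τ(g) e)` and `W_v(diag(u,1)) = kirillovFn hτ ℓ v u`.
[cite: JacquetLanglands1970, proof of Thm. 11.1 (p. 173)] -/
theorem tildeFn_archWhittakerFn_diagGL2 (hτ : τ.IsStronglyContinuous) (ℓ : archGardingSpace hcpt τ →ₗ[ℂ] ℂ)
    {ω : (mixedSpace K)ˣ → ℂ}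
    (hω : ∀ (c : (mixedSpace K)ˣ) (v : E), τ (toArch hcpt (glDiagonal 2 (mixedSpace K) fun _ => c)) v = ω c • v)
    (e : archGardingSpace hcpt τ) (u : (mixedSpace K)ˣ) :
    tildeFn (fun g : GL (Fin 2) (mixedSpace K) => ℓ ⟨τ (toArch hcpt g) (e : E), apply_mem_archGardingSpace hτ _ e.2⟩)
        (diagGL2 u 1) =
      ω u⁻¹ * kirillovFn hτ ℓ (gardingAct hτ (weylLong 2 (mixedSpace K)) e) u := by
  have key : (⟨τ (toArch hcpt (weylLong 2 (mixedSpace K) *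
        GaloisRepresentations.glTransposeInv (Fin 2) (mixedSpace K) (diagGL2 u 1))) (e : E),
        apply_mem_archGardingSpace hτ _ e.2⟩ : archGardingSpace hcpt τ) =
      ω u⁻¹ • (⟨τ (toArch hcpt (diagGL2 u 1)) ((gardingAct hτ (weylLong 2 (mixedSpace K)) e : archGardingSpace hcpt τ) : E),
        apply_mem_archGardingSpace hτ _ (gardingAct hτ (weylLong 2 (mixedSpace K)) e).2⟩ : archGardingSpace hcpt τ) := by
    refine Subtype.ext ?_
    change τ (toArch hcpt (weylLong 2 (mixedSpace K) *
        GaloisRepresentations.glTransposeInv (Fin 2) (mixedSpace K) (diagGL2 u 1))) (e : E) =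
      ω u⁻¹ • τ (toArch hcpt (diagGL2 u 1)) (τ (toArch hcpt (weylLong 2 (mixedSpace K))) (e : E))
    rw [weylLong_two_mul_glTransposeInv_diagGL2,
      show toArch hcpt (glDiagonal 2 (mixedSpace K) (fun _ => u⁻¹) * (diagGL2 u 1 * weylLong 2 (mixedSpace K))) =
        toArch hcpt (glDiagonal 2 (mixedSpace K) fun _ => u⁻¹) *
          (toArch hcpt (diagGL2 u 1) * toArch hcpt (weylLong 2 (mixedSpace K))) from rfl,
      map_mul, map_mul]
    exact hω u⁻¹ _
  rw [tildeFn_apply, kirillovFn_apply, key, map_smul, smul_eq_mul]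

/-- The same identity for the dual Hecke integrand against `N(u)^{s - 1/2}`. [folklore] -/
theorem tildeFn_archWhittakerFn_diagGL2_mul (hτ : τ.IsStronglyContinuous) (ℓ : archGardingSpace hcpt τ →ₗ[ℂ] ℂ)
    {ω : (mixedSpace K)ˣ → ℂ}
    (hω : ∀ (c : (mixedSpace K)ˣ) (v : E), τ (toArch hcpt (glDiagonal 2 (mixedSpace K) fun _ => c)) v = ω c • v)
    (e : archGardingSpace hcpt τ) (s : ℂ) :
    (fun u : (mixedSpace K)ˣ =>
        tildeFn (fun g : GL (Fin 2) (mixedSpace K) => ℓ ⟨τ (toArch hcpt g) (e : E), apply_mem_archGardingSpace hτ _ e.2⟩)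
            (diagGL2 u 1) *
          ((mixedEmbedding.norm ((u : (mixedSpace K)ˣ) : mixedSpace K) : ℝ) : ℂ) ^ (s - 1 / 2)) =
      fun u : (mixedSpace K)ˣ =>
        ω u⁻¹ * kirillovFn hτ ℓ (gardingAct hτ (weylLong 2 (mixedSpace K)) e) u *
          ((mixedEmbedding.norm ((u : (mixedSpace K)ˣ) : mixedSpace K) : ℝ) : ℂ) ^ (s - 1 / 2) := by
  funext u
  rw [tildeFn_archWhittakerFn_diagGL2 hτ ℓ hω e u]

/-- `τ(w) e` is again `K_∞`-finite (indeed `w ∈ K_∞`, so its `K_∞`-span is contained in that of `e`). [folklore] -/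
theorem span_range_gardingAct_weylLong_le (hτ : τ.IsStronglyContinuous) (e : archGardingSpace hcpt τ) :
    Submodule.span ℂ (Set.range fun κ : (AutomorphyDatum.gl 2 K hcpt).arch.maximalCompact =>
        τ (toArch hcpt (κ : GL (Fin 2) (mixedSpace K))) ((gardingAct hτ (weylLong 2 (mixedSpace K)) e : archGardingSpace hcpt τ) : E)) ≤
      Submodule.span ℂ (Set.range fun κ : (AutomorphyDatum.gl 2 K hcpt).arch.maximalCompact =>
        τ (toArch hcpt (κ : GL (Fin 2) (mixedSpace K))) (e : E)) := by
  refine Submodule.span_le.2 ?_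
  rintro _ ⟨κ, rfl⟩
  refine Submodule.subset_span ⟨κ * ⟨weylLong 2 (mixedSpace K), weylLong_mem_Kinf⟩, ?_⟩
  change τ (toArch hcpt ((κ : GL (Fin 2) (mixedSpace K)) * weylLong 2 (mixedSpace K))) (e : E) =
    τ (toArch hcpt (κ : GL (Fin 2) (mixedSpace K))) (τ (toArch hcpt (weylLong 2 (mixedSpace K))) (e : E))
  rw [show toArch hcpt ((κ : GL (Fin 2) (mixedSpace K)) * weylLong 2 (mixedSpace K)) =
      toArch hcpt (κ : GL (Fin 2) (mixedSpace K)) * toArch hcpt (weylLong 2 (mixedSpace K)) from rfl,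
    map_mul]
  rfl

/-- Hence `τ(w) e` is `K_∞`-finite when `e` is. [folklore] -/
theorem finiteDimensional_span_range_gardingAct_weylLong (hτ : τ.IsStronglyContinuous) (e : archGardingSpace hcpt τ)
    (he : FiniteDimensional ℂ (Submodule.span ℂ (Set.range fun κ : (AutomorphyDatum.gl 2 K hcpt).arch.maximalCompact =>
        τ (toArch hcpt (κ : GL (Fin 2) (mixedSpace K))) (e : E)))) :
    FiniteDimensional ℂ (Submodule.span ℂ (Set.range fun κ : (AutomorphyDatum.gl 2 K hcpt).arch.maximalCompact =>
        τ (toArch hcpt (κ : GL (Fin 2) (mixedSpace K))) ((gardingAct hτ (weylLong 2 (mixedSpace K)) e : archGardingSpace hcpt τ) : E))) :=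
  Submodule.finiteDimensional_of_le (span_range_gardingAct_weylLong_le hτ e)

end Kirillov

/-! ### 3. The Kirillov-only archimedean input -/

section MinW

/-- **The analytic package `(IR)` for clean `A_G`-invariant cuspidal data of `GL₂(𝔸_F)` from the
KIRILLOV-ONLY archimedean input.** For the archimedean component `τ` of every cuspidal `Π ≤ L²_cusp(GL₂)`
(irreducible unitary, with its central character `ω`, `τ(c·1) = ω(c)`, `|ω| = 1`, handed over as data), the
transfer `ℓ_∞` of the global Whittaker functional and any Haar measure of `K_∞ˣ`: ONE `K_∞`-finite Gårding vector
`e₀` such that the two Mellin transforms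

  `∫ W_{e₀}(diag(u,1)) N(u)^{s-1/2} d^×u`  and  `∫ ω(u⁻¹) W_{τ(w)e₀}(diag(u,1)) N(u)^{s-1/2} d^×u`

(`W_v(diag(u,1)) = kirillovFn hτ ℓ v u`, `w = weylLong 2`) converge absolutely on a right half-plane and
have there ENTIRE RECIPROCALS `Γ_∞`, `Γ̃_∞` whose zeros lie on finitely many horizontal lines. By
`tildeFn_archWhittakerFn_diagGL2` this is `integralRepresentation_clean_of_archHeckeTestVectorMin`.
[cite: JacquetLanglands1970, Thm. 5.15, Thm. 6.4, proof of Thm. 11.1 (pp. 171–173)] -/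
theorem integralRepresentation_clean_of_archHeckeTestVectorMinW
    (hA : ∀ (K : Type) [Field K] [NumberField K] (hcpt : isCompact_glFiniteIntegralLevel 2 K)
      (μ : Measure (AdelicGroupData.gl 2 K).automorphicQuotient) [(AdelicGroupData.gl 2 K).IsAutomorphicMeasure μ]
      (Pl : CuspidalAutomorphicRepGL 2 K μ)
      (E : Type) [NormedAddCommGroup E] [InnerProductSpace ℂ E] [CompleteSpace E]
      (τ : ContRepresentation ℂ (AutomorphyDatum.gl 2 K hcpt).arch.carrier E) (hτ : τ.IsStronglyContinuous)
      (_ : τ.IsUnitary) (_ : τ.IsTopIrreducible) (_ : ∃ T ∈ archIntertwiners hcpt τ Pl.1, T ≠ 0)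
      (ω : (mixedSpace K)ˣ → ℂ) (_ : ∀ c, ‖ω c‖ = 1)
      (_ : ∀ (c : (mixedSpace K)ˣ) (v : E), τ (toArch hcpt (glDiagonal 2 (mixedSpace K) fun _ => c)) v = ω c • v)
      (ℓ : archGardingSpace hcpt τ →ₗ[ℂ] ℂ) (_ : IsArchContWhittakerFunctional hcpt τ hτ ℓ) (_ : ℓ ≠ 0)
      [MeasurableSpace ((mixedSpace K)ˣ)] [BorelSpace ((mixedSpace K)ˣ)]
      (μ' : Measure ((mixedSpace K)ˣ)) (_ : IsHaarMeasure μ'),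
      ∃ (e₀ : archGardingSpace hcpt τ)
        (_ : FiniteDimensional ℂ (Submodule.span ℂ (Set.range
          fun κ : (AutomorphyDatum.gl 2 K hcpt).arch.maximalCompact =>
            τ (toArch hcpt (κ : GL (Fin 2) (mixedSpace K))) (e₀ : E))))
        (Γi Γi' : ℂ → ℂ) (_ : Differentiable ℂ Γi) (_ : Differentiable ℂ Γi')
        (_ : ∃ Y : Set ℝ, Y.Finite ∧ ∀ s, Γi s = 0 → s.im ∈ Y)
        (_ : ∃ Y : Set ℝ, Y.Finite ∧ ∀ s, Γi' s = 0 → s.im ∈ Y) (x₀ : ℝ),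
        ∀ s : ℂ, x₀ < s.re →
          (Integrable (fun u : (mixedSpace K)ˣ =>
              kirillovFn hτ ℓ e₀ u *
                ((mixedEmbedding.norm ((u : (mixedSpace K)ˣ) : mixedSpace K) : ℝ) : ℂ) ^ (s - 1 / 2)) μ' ∧
            Γi s * ∫ u : (mixedSpace K)ˣ, kirillovFn hτ ℓ e₀ u *
                ((mixedEmbedding.norm ((u : (mixedSpace K)ˣ) : mixedSpace K) : ℝ) : ℂ) ^ (s - 1 / 2) ∂μ' = 1) ∧
          (Integrable (fun u : (mixedSpace K)ˣ =>
              ω u⁻¹ * kirillovFn hτ ℓ (gardingAct hτ (weylLong 2 (mixedSpace K)) e₀) u *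
                ((mixedEmbedding.norm ((u : (mixedSpace K)ˣ) : mixedSpace K) : ℝ) : ℂ) ^ (s - 1 / 2)) μ' ∧
            Γi' s * ∫ u : (mixedSpace K)ˣ,
                ω u⁻¹ * kirillovFn hτ ℓ (gardingAct hτ (weylLong 2 (mixedSpace K)) e₀) u *
                  ((mixedEmbedding.norm ((u : (mixedSpace K)ˣ) : mixedSpace K) : ℝ) : ℂ) ^ (s - 1 / 2) ∂μ' = 1))
    {F : Type} [Field F] [NumberField F] (hcpt : isCompact_glFiniteIntegralLevel 2 F)
    (π : CuspidalAutomorphicRepData 2 F hcpt) (P P' : HeightOneSpectrum (𝓞 F) → ℂ[X])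
    (hbot : π.1.W' = ⊥)
    (hAG : ∀ φ ∈ π.1.W, ∀ (t : ℝ≥0ˣ) (g : (AdelicGroupData.gl 2 F).Adelic),
      φ ((show (AdelicGroupData.gl 2 F).Adelic from posRealScalar 2 F t) * g) = φ g)
    (hP : ∀ (u : HeightOneSpectrum (𝓞 F)) (πu : SmoothIrrep (GL (Fin 2) (u.adicCompletion F))),
      π.1.HasLocalComponentAt u πu.ρ →
      ∀ (ψ : AddChar (u.adicCompletion F) Circle), ψ.IsContinuousNontrivial →
      ∀ [MeasurableSpace (u.adicCompletion F)] [BorelSpace (u.adicCompletion F)]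
        [MeasurableSpace (GL (Fin 1) (u.adicCompletion F) ⧸ upperUnitriangular (Fin 1) (u.adicCompletion F))]
        [BorelSpace (GL (Fin 1) (u.adicCompletion F) ⧸ upperUnitriangular (Fin 1) (u.adicCompletion F))]
        (ν : Measure (GL (Fin 1) (u.adicCompletion F) ⧸ upperUnitriangular (Fin 1) (u.adicCompletion F)))
        [SMulInvariantMeasure (GL (Fin 1) (u.adicCompletion F))
          (GL (Fin 1) (u.adicCompletion F) ⧸ upperUnitriangular (Fin 1) (u.adicCompletion F)) ν]
        [IsFiniteMeasureOnCompacts ν] [ν.IsOpenPosMeasure],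
        HasRSLFactor Nat.one_lt_two πu.ρ
          (Representation.trivial ℂ (GL (Fin 1) (u.adicCompletion F)) ℂ) ψ ν (P u))
    (hP' : ∀ (u : HeightOneSpectrum (𝓞 F)) (πu : SmoothIrrep (GL (Fin 2) (u.adicCompletion F))),
      π.transposeInv.1.HasLocalComponentAt u πu.ρ →
      ∀ (ψ : AddChar (u.adicCompletion F) Circle), ψ.IsContinuousNontrivial →
      ∀ [MeasurableSpace (u.adicCompletion F)] [BorelSpace (u.adicCompletion F)]
        [MeasurableSpace (GL (Fin 1) (u.adicCompletion F) ⧸ upperUnitriangular (Fin 1) (u.adicCompletion F))]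
        [BorelSpace (GL (Fin 1) (u.adicCompletion F) ⧸ upperUnitriangular (Fin 1) (u.adicCompletion F))]
        (ν : Measure (GL (Fin 1) (u.adicCompletion F) ⧸ upperUnitriangular (Fin 1) (u.adicCompletion F)))
        [SMulInvariantMeasure (GL (Fin 1) (u.adicCompletion F))
          (GL (Fin 1) (u.adicCompletion F) ⧸ upperUnitriangular (Fin 1) (u.adicCompletion F)) ν]
        [IsFiniteMeasureOnCompacts ν] [ν.IsOpenPosMeasure],
        HasRSLFactor Nat.one_lt_two πu.ρ
          (Representation.trivial ℂ (GL (Fin 1) (u.adicCompletion F)) ℂ) ψ ν (P' u)) :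
    ∃ (c₀ : ℝ) (Z Z' J J' Γ Γ' η : ℂ → ℂ),
      Differentiable ℂ Z ∧ Differentiable ℂ Z' ∧ Differentiable ℂ J ∧ Differentiable ℂ J' ∧
      Differentiable ℂ Γ ∧ Differentiable ℂ Γ' ∧
      (∃ Y : Set ℝ, Y.Finite ∧ ∀ s, Γ s = 0 → s.im ∈ Y) ∧
      (∃ Y : Set ℝ, Y.Finite ∧ ∀ s, Γ' s = 0 → s.im ∈ Y) ∧
      (∀ s : ℂ, c₀ < s.re → J s ≠ 0 ∧ Z s * Γ s =
        J s * ∏' u : HeightOneSpectrum (𝓞 F), ((P u).eval ((u.residueCard : ℂ) ^ (-s)))⁻¹) ∧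
      (∀ s : ℂ, c₀ < s.re → J' s ≠ 0 ∧ Z' s * Γ' s =
        J' s * ∏' u : HeightOneSpectrum (𝓞 F), ((P' u).eval ((u.residueCard : ℂ) ^ (-s)))⁻¹) ∧
      (∀ s, Z s = Z' (1 - s)) ∧
      Continuous η ∧ (∀ s, η s ≠ 0) ∧ (∀ s, J' (1 - s) = η s * J s) := by
  refine integralRepresentation_clean_of_archHeckeTestVectorMin ?_ hcpt π P P' hbot hAG hP hP'
  intro K _ _ hcptK μ _ Pl E _ _ _ τ hτ hτu hτi hex ℓ hℓ hℓ0 _ _ μ' hμ'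
  obtain ⟨ω, hω⟩ := exists_apply_glDiagonal_const_eq_smul (hcpt := hcptK) (τ := τ) hτu hτi
  obtain ⟨e₀, he₀, Γi, Γi', hΓi, hΓi', hY, hY', x₀, hI⟩ :=
    hA K hcptK μ Pl E τ hτ hτu hτi hex ω (fun c => (hω c).1) (fun c v => (hω c).2 v) ℓ hℓ hℓ0 μ' hμ'
  refine ⟨e₀, he₀, Γi, Γi', hΓi, hΓi', hY, hY', x₀, fun s hs => ⟨(hI s hs).1, ?_⟩⟩
  rw [tildeFn_archWhittakerFn_diagGL2_mul hτ ℓ (fun c v => (hω c).2 v) e₀ s]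
  exact (hI s hs).2

/-- **Jacquet–Langlands (1970), Thm. 11.1 / Cor. 11.2 (the named fact `JacquetLanglands1970_standardLTheoryGL2`)
from the Kirillov-only archimedean input.** [cite: JacquetLanglands1970, Thm. 11.1, Cor. 11.2, Thm. 5.15, Thm. 6.4] -/
theorem JacquetLanglands1970_standardLTheoryGL2_of_archHeckeTestVectorMinW
    (hA : ∀ (K : Type) [Field K] [NumberField K] (hcpt : isCompact_glFiniteIntegralLevel 2 K)
      (μ : Measure (AdelicGroupData.gl 2 K).automorphicQuotient) [(AdelicGroupData.gl 2 K).IsAutomorphicMeasure μ]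
      (Pl : CuspidalAutomorphicRepGL 2 K μ)
      (E : Type) [NormedAddCommGroup E] [InnerProductSpace ℂ E] [CompleteSpace E]
      (τ : ContRepresentation ℂ (AutomorphyDatum.gl 2 K hcpt).arch.carrier E) (hτ : τ.IsStronglyContinuous)
      (_ : τ.IsUnitary) (_ : τ.IsTopIrreducible) (_ : ∃ T ∈ archIntertwiners hcpt τ Pl.1, T ≠ 0)
      (ω : (mixedSpace K)ˣ → ℂ) (_ : ∀ c, ‖ω c‖ = 1)
      (_ : ∀ (c : (mixedSpace K)ˣ) (v : E), τ (toArch hcpt (glDiagonal 2 (mixedSpace K) fun _ => c)) v = ω c • v)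
      (ℓ : archGardingSpace hcpt τ →ₗ[ℂ] ℂ) (_ : IsArchContWhittakerFunctional hcpt τ hτ ℓ) (_ : ℓ ≠ 0)
      [MeasurableSpace ((mixedSpace K)ˣ)] [BorelSpace ((mixedSpace K)ˣ)]
      (μ' : Measure ((mixedSpace K)ˣ)) (_ : IsHaarMeasure μ'),
      ∃ (e₀ : archGardingSpace hcpt τ)
        (_ : FiniteDimensional ℂ (Submodule.span ℂ (Set.range
          fun κ : (AutomorphyDatum.gl 2 K hcpt).arch.maximalCompact =>
            τ (toArch hcpt (κ : GL (Fin 2) (mixedSpace K))) (e₀ : E))))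
        (Γi Γi' : ℂ → ℂ) (_ : Differentiable ℂ Γi) (_ : Differentiable ℂ Γi')
        (_ : ∃ Y : Set ℝ, Y.Finite ∧ ∀ s, Γi s = 0 → s.im ∈ Y)
        (_ : ∃ Y : Set ℝ, Y.Finite ∧ ∀ s, Γi' s = 0 → s.im ∈ Y) (x₀ : ℝ),
        ∀ s : ℂ, x₀ < s.re →
          (Integrable (fun u : (mixedSpace K)ˣ =>
              kirillovFn hτ ℓ e₀ u *
                ((mixedEmbedding.norm ((u : (mixedSpace K)ˣ) : mixedSpace K) : ℝ) : ℂ) ^ (s - 1 / 2)) μ' ∧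
            Γi s * ∫ u : (mixedSpace K)ˣ, kirillovFn hτ ℓ e₀ u *
                ((mixedEmbedding.norm ((u : (mixedSpace K)ˣ) : mixedSpace K) : ℝ) : ℂ) ^ (s - 1 / 2) ∂μ' = 1) ∧
          (Integrable (fun u : (mixedSpace K)ˣ =>
              ω u⁻¹ * kirillovFn hτ ℓ (gardingAct hτ (weylLong 2 (mixedSpace K)) e₀) u *
                ((mixedEmbedding.norm ((u : (mixedSpace K)ˣ) : mixedSpace K) : ℝ) : ℂ) ^ (s - 1 / 2)) μ' ∧
            Γi' s * ∫ u : (mixedSpace K)ˣ,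
                ω u⁻¹ * kirillovFn hτ ℓ (gardingAct hτ (weylLong 2 (mixedSpace K)) e₀) u *
                  ((mixedEmbedding.norm ((u : (mixedSpace K)ˣ) : mixedSpace K) : ℝ) : ℂ) ^ (s - 1 / 2) ∂μ' = 1)) :
    JacquetLanglands1970_standardLTheoryGL2 :=
  JacquetLanglands1970_standardLTheoryGL2_of_integralRepresentation_clean
    fun hcpt π P P' hbot hAG hP hP' =>
      integralRepresentation_clean_of_archHeckeTestVectorMinW hA hcpt π P P' hbot hAG hP hP'

/-- **Gelbart (1997), Prop. 4.1 at the σ-unramified places (the named fact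
`frobSatakeCompatibleAt_of_isPiOfArtinRep_of_isUnramifiedAt`) from the Kirillov-only archimedean input.**
[cite: Gelbart1997, Prop. 4.1] [cite: JacquetLanglands1970, Thm. 12.2, Thm. 11.1, Thm. 5.15, Thm. 6.4] -/
theorem frobSatakeCompatibleAt_of_isPiOfArtinRep_of_isUnramifiedAt_of_archHeckeTestVectorMinW
    (hA : ∀ (K : Type) [Field K] [NumberField K] (hcpt : isCompact_glFiniteIntegralLevel 2 K)
      (μ : Measure (AdelicGroupData.gl 2 K).automorphicQuotient) [(AdelicGroupData.gl 2 K).IsAutomorphicMeasure μ]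
      (Pl : CuspidalAutomorphicRepGL 2 K μ)
      (E : Type) [NormedAddCommGroup E] [InnerProductSpace ℂ E] [CompleteSpace E]
      (τ : ContRepresentation ℂ (AutomorphyDatum.gl 2 K hcpt).arch.carrier E) (hτ : τ.IsStronglyContinuous)
      (_ : τ.IsUnitary) (_ : τ.IsTopIrreducible) (_ : ∃ T ∈ archIntertwiners hcpt τ Pl.1, T ≠ 0)
      (ω : (mixedSpace K)ˣ → ℂ) (_ : ∀ c, ‖ω c‖ = 1)
      (_ : ∀ (c : (mixedSpace K)ˣ) (v : E), τ (toArch hcpt (glDiagonal 2 (mixedSpace K) fun _ => c)) v = ω c • v)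
      (ℓ : archGardingSpace hcpt τ →ₗ[ℂ] ℂ) (_ : IsArchContWhittakerFunctional hcpt τ hτ ℓ) (_ : ℓ ≠ 0)
      [MeasurableSpace ((mixedSpace K)ˣ)] [BorelSpace ((mixedSpace K)ˣ)]
      (μ' : Measure ((mixedSpace K)ˣ)) (_ : IsHaarMeasure μ'),
      ∃ (e₀ : archGardingSpace hcpt τ)
        (_ : FiniteDimensional ℂ (Submodule.span ℂ (Set.range
          fun κ : (AutomorphyDatum.gl 2 K hcpt).arch.maximalCompact =>
            τ (toArch hcpt (κ : GL (Fin 2) (mixedSpace K))) (e₀ : E))))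
        (Γi Γi' : ℂ → ℂ) (_ : Differentiable ℂ Γi) (_ : Differentiable ℂ Γi')
        (_ : ∃ Y : Set ℝ, Y.Finite ∧ ∀ s, Γi s = 0 → s.im ∈ Y)
        (_ : ∃ Y : Set ℝ, Y.Finite ∧ ∀ s, Γi' s = 0 → s.im ∈ Y) (x₀ : ℝ),
        ∀ s : ℂ, x₀ < s.re →
          (Integrable (fun u : (mixedSpace K)ˣ =>
              kirillovFn hτ ℓ e₀ u *
                ((mixedEmbedding.norm ((u : (mixedSpace K)ˣ) : mixedSpace K) : ℝ) : ℂ) ^ (s - 1 / 2)) μ' ∧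
            Γi s * ∫ u : (mixedSpace K)ˣ, kirillovFn hτ ℓ e₀ u *
                ((mixedEmbedding.norm ((u : (mixedSpace K)ˣ) : mixedSpace K) : ℝ) : ℂ) ^ (s - 1 / 2) ∂μ' = 1) ∧
          (Integrable (fun u : (mixedSpace K)ˣ =>
              ω u⁻¹ * kirillovFn hτ ℓ (gardingAct hτ (weylLong 2 (mixedSpace K)) e₀) u *
                ((mixedEmbedding.norm ((u : (mixedSpace K)ˣ) : mixedSpace K) : ℝ) : ℂ) ^ (s - 1 / 2)) μ' ∧
            Γi' s * ∫ u : (mixedSpace K)ˣ,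
                ω u⁻¹ * kirillovFn hτ ℓ (gardingAct hτ (weylLong 2 (mixedSpace K)) e₀) u *
                  ((mixedEmbedding.norm ((u : (mixedSpace K)ˣ) : mixedSpace K) : ℝ) : ℂ) ^ (s - 1 / 2) ∂μ' = 1)) :
    frobSatakeCompatibleAt_of_isPiOfArtinRep_of_isUnramifiedAt :=
  frobSatakeCompatibleAt_of_isPiOfArtinRep_of_isUnramifiedAt_of_JacquetLanglands1970_standardLTheoryGL2
    (JacquetLanglands1970_standardLTheoryGL2_of_archHeckeTestVectorMinW hA)

/-- The Galois-twisted Hecke theory `JacquetLanglands1970_twistedHeckeTheoryGL2` and the `π`-unramified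
companion `frobSatakeCompatibleAt_of_isPiOfArtinRep` from the Kirillov-only archimedean input.
[cite: Gelbart1997, Prop. 4.1] [cite: JacquetLanglands1970, Thm. 11.1, Cor. 11.2, Thm. 5.15, Thm. 6.4] -/
theorem JacquetLanglands1970_twistedHeckeTheoryGL2_and_frobSatakeCompatibleAt_of_archHeckeTestVectorMinW
    (hA : ∀ (K : Type) [Field K] [NumberField K] (hcpt : isCompact_glFiniteIntegralLevel 2 K)
      (μ : Measure (AdelicGroupData.gl 2 K).automorphicQuotient) [(AdelicGroupData.gl 2 K).IsAutomorphicMeasure μ]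
      (Pl : CuspidalAutomorphicRepGL 2 K μ)
      (E : Type) [NormedAddCommGroup E] [InnerProductSpace ℂ E] [CompleteSpace E]
      (τ : ContRepresentation ℂ (AutomorphyDatum.gl 2 K hcpt).arch.carrier E) (hτ : τ.IsStronglyContinuous)
      (_ : τ.IsUnitary) (_ : τ.IsTopIrreducible) (_ : ∃ T ∈ archIntertwiners hcpt τ Pl.1, T ≠ 0)
      (ω : (mixedSpace K)ˣ → ℂ) (_ : ∀ c, ‖ω c‖ = 1)
      (_ : ∀ (c : (mixedSpace K)ˣ) (v : E), τ (toArch hcpt (glDiagonal 2 (mixedSpace K) fun _ => c)) v = ω c • v)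
      (ℓ : archGardingSpace hcpt τ →ₗ[ℂ] ℂ) (_ : IsArchContWhittakerFunctional hcpt τ hτ ℓ) (_ : ℓ ≠ 0)
      [MeasurableSpace ((mixedSpace K)ˣ)] [BorelSpace ((mixedSpace K)ˣ)]
      (μ' : Measure ((mixedSpace K)ˣ)) (_ : IsHaarMeasure μ'),
      ∃ (e₀ : archGardingSpace hcpt τ)
        (_ : FiniteDimensional ℂ (Submodule.span ℂ (Set.range
          fun κ : (AutomorphyDatum.gl 2 K hcpt).arch.maximalCompact =>
            τ (toArch hcpt (κ : GL (Fin 2) (mixedSpace K))) (e₀ : E))))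
        (Γi Γi' : ℂ → ℂ) (_ : Differentiable ℂ Γi) (_ : Differentiable ℂ Γi')
        (_ : ∃ Y : Set ℝ, Y.Finite ∧ ∀ s, Γi s = 0 → s.im ∈ Y)
        (_ : ∃ Y : Set ℝ, Y.Finite ∧ ∀ s, Γi' s = 0 → s.im ∈ Y) (x₀ : ℝ),
        ∀ s : ℂ, x₀ < s.re →
          (Integrable (fun u : (mixedSpace K)ˣ =>
              kirillovFn hτ ℓ e₀ u *
                ((mixedEmbedding.norm ((u : (mixedSpace K)ˣ) : mixedSpace K) : ℝ) : ℂ) ^ (s - 1 / 2)) μ' ∧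
            Γi s * ∫ u : (mixedSpace K)ˣ, kirillovFn hτ ℓ e₀ u *
                ((mixedEmbedding.norm ((u : (mixedSpace K)ˣ) : mixedSpace K) : ℝ) : ℂ) ^ (s - 1 / 2) ∂μ' = 1) ∧
          (Integrable (fun u : (mixedSpace K)ˣ =>
              ω u⁻¹ * kirillovFn hτ ℓ (gardingAct hτ (weylLong 2 (mixedSpace K)) e₀) u *
                ((mixedEmbedding.norm ((u : (mixedSpace K)ˣ) : mixedSpace K) : ℝ) : ℂ) ^ (s - 1 / 2)) μ' ∧
            Γi' s * ∫ u : (mixedSpace K)ˣ,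
                ω u⁻¹ * kirillovFn hτ ℓ (gardingAct hτ (weylLong 2 (mixedSpace K)) e₀) u *
                  ((mixedEmbedding.norm ((u : (mixedSpace K)ˣ) : mixedSpace K) : ℝ) : ℂ) ^ (s - 1 / 2) ∂μ' = 1)) :
    JacquetLanglands1970_twistedHeckeTheoryGL2 ∧ frobSatakeCompatibleAt_of_isPiOfArtinRep :=
  ⟨JacquetLanglands1970_twistedHeckeTheoryGL2_of_JacquetLanglands1970_standardLTheoryGL2
      (JacquetLanglands1970_standardLTheoryGL2_of_archHeckeTestVectorMinW hA),
    frobSatakeCompatibleAt_of_isPiOfArtinRep_of_JacquetLanglands1970_standardLTheoryGL2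
      (JacquetLanglands1970_standardLTheoryGL2_of_archHeckeTestVectorMinW hA)⟩

end MinW

end Literature.NumberTheory.Automorphic
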